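import Mathlib
import Summits.ResolutionOfSingularities.ResolutionOfSingularities.Theorems.SyzygyFlatteningDefs
import Summits.ResolutionOfSingularities.ResolutionOfSingularities.Theorems.SyzygyFlatteningHigherRankTerminationSingIdealLocAt
import Summits.ResolutionOfSingularities.ResolutionOfSingularities.Theorems.SyzygyFlatteningHigherRankTerminationRegularLocusPolynomial
import Literature.AlgebraicGeometry.Resolution.ExcellentRings
import HarnessLib

/-!
# The ideal of the non-regular locus commutes with the base change `B ↦ k(X)·B`
(`stub_singIdeal_baseChange`)

Crux `HigherRankTermination` (stmt-ResolutionOfSingularities-17045), line `birth`, base-change line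
of `stub_posDimRankOne`, registered stub `stub_singIdeal_baseChange` (held by the lead).

For a model `B ⊆ K` essentially of finite type over the field `k` and its base change
`E = k(X)·B ⊆ K(X)` (the `k(X)`-subalgebra generated by `B`, a localisation of the polynomial ring
`B[X]` — `stub_baseChange_isLocalization`, fed here as a hypothesis), the ideal `singIdeal` of the
non-regular locus (the intersection of the non-regular primes) of `E` is the extension of
`singIdeal B` along `ψ : B → E`:

* `Reg(B)` is open (Matsumura, Cor. to Thm. 30.5; landed `isOpen_regularLocus_of_essFiniteType`),
  so `Reg(B[X])ᶜ`, the preimage of `Reg(B)ᶜ` (landed `compl_regularLocus_polynomial`), is closed and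
  its vanishing ideal is `(J B) B[X]` (landed `vanishingIdeal_compl_regularLocus_polynomial`; also the
  content of the hypothesis `stub_regularLocus_polynomial`);
* along the localisation `B[X] → E` vanishing ideals of non-regular loci extend (landed
  `vanishingIdeal_compl_regularLocus_of_isLocalization`);
* `singIdeal` IS that vanishing ideal (landed `singIdeal_eq_vanishingIdeal`), and
  `(eval at X) ∘ C = ψ`.

References: Matsumura, *Commutative Ring Theory*, §30 Cor. to Thm. 30.5 (openness of `Reg` over a
field), Thm. 23.7 (regularity along flat local maps).
-/

noncomputable section

-- single-problem summit: the doubled namespace component `ResolutionOfSingularities` is forced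
set_option linter.dupNamespace false

namespace Summit.ResolutionOfSingularities.ResolutionOfSingularities.Theorems.SyzygyFlattening

open Polynomial Literature.AlgebraicGeometry.Resolution

/-- **Abstract form.** For a Noetherian `k`-algebra `R` essentially of finite type over the field `k`
and a localisation `T` of `R[X]`, the vanishing ideal of the non-regular locus of `T` is the extension
of that of `R` along `R → R[X] → T`. [cite: Matsumura1987, §30 Cor. to Thm. 30.5] -/
theorem vanishingIdeal_compl_regularLocus_of_isLocalization_polynomial (k R T : Type) [Field k]
    [CommRing R] [Algebra k R] [Algebra.EssFiniteType k R] [IsNoetherianRing R] [CommRing T]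
    [Algebra R[X] T] (N : Submonoid R[X]) [IsLocalization N T] :
    PrimeSpectrum.vanishingIdeal (regularLocus T)ᶜ =
      ((PrimeSpectrum.vanishingIdeal (regularLocus R)ᶜ).map (C : R →+* R[X])).map
        (algebraMap R[X] T) := by
  have hopen : IsOpen (regularLocus R) := isOpen_regularLocus_of_essFiniteType k R
  have hclosed : IsClosed (regularLocus R)ᶜ := isClosed_compl_iff.mpr hopen
  have hclosedX : IsClosed (regularLocus R[X])ᶜ := by
    rw [compl_regularLocus_polynomial R]
    exact hclosed.preimage (PrimeSpectrum.continuous_comap (C : R →+* R[X]))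
  rw [vanishingIdeal_compl_regularLocus_of_isLocalization N hclosedX,
    vanishingIdeal_compl_regularLocus_polynomial R hclosed]

/-- **STUB `stub_singIdeal_baseChange` (the non-regular locus commutes with the base change
`B ↦ E = k(X)·B`).** For `B ⊆ K` essentially of finite type over `k`, `singIdeal E = (singIdeal B) E`
along `ψ : B → E`: `Reg(B)` is open (Matsumura, Cor. to Thm. 30.5), `Reg(B[X])ᶜ` is the preimage of
`Reg(B)ᶜ` with vanishing ideal `(J B)[X]`, and `E` is a localisation of `B[X]`, along which vanishing
ideals of non-regular loci extend; finally `(f ↦ f(X)) ∘ C = ψ`. (The hypothesis restating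
`stub_regularLocus_polynomial` is not needed: that stub has landed and is used by name.)
[cite: Matsumura1987, §30 Cor. to Thm. 30.5] -/
theorem stub_singIdeal_baseChange : ∀ (k K : Type) [Field k] [Field K] [Algebra k K],
    ∀ (k' : Type) [Field k'] [Algebra k k'] [Algebra k' (RatFunc K)] [IsScalarTower k k' (RatFunc K)],
      Set.range (algebraMap k' (RatFunc K)) =
        ((IntermediateField.adjoin k {(RatFunc.X : RatFunc K)} : IntermediateField k (RatFunc K)) :
          Set (RatFunc K)) →
    ∀ (B : Subalgebra k K) (E : Subalgebra k' (RatFunc K)),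
      E = Algebra.adjoin k' ((algebraMap K (RatFunc K)) '' (B : Set K)) → Algebra.EssFiniteType k ↥B →
    ∀ (ψ : ↥B →+* ↥E) (XE : ↥E),
      (∀ b : ↥B, (ψ b : RatFunc K) = algebraMap K (RatFunc K) b) → (XE : RatFunc K) = RatFunc.X →
      @IsLocalization (Polynomial ↥B) _
        ((nonZeroDivisors (Polynomial k)).map (Polynomial.mapRingHom (algebraMap k ↥B)))
        ↥E _ (Polynomial.eval₂RingHom ψ XE).toAlgebra →
      (∀ (R : Type) [CommRing R] [IsNoetherianRing R],
        (∀ (P : Ideal (Polynomial R)) [P.IsPrime],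
          IsRegularLocalRing (Localization.AtPrime P) ↔
            IsRegularLocalRing (Localization.AtPrime (P.comap (Polynomial.C : R →+* Polynomial R)))) ∧
        (IsClosed (regularLocus R)ᶜ →
          PrimeSpectrum.vanishingIdeal (regularLocus (Polynomial R))ᶜ =
            (PrimeSpectrum.vanishingIdeal (regularLocus R)ᶜ).map (Polynomial.C : R →+* Polynomial R))) →
      singIdeal E = (singIdeal B).map ψ := by
  intro k K _ _ _ k' _ _ _ _ _ B E _ hess ψ XE _ _ hloc _
  letI : Algebra (Polynomial ↥B) ↥E := (Polynomial.eval₂RingHom ψ XE).toAlgebra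
  haveI : IsLocalization ((nonZeroDivisors (Polynomial k)).map
      (Polynomial.mapRingHom (algebraMap k ↥B))) ↥E := hloc
  haveI : Algebra.EssFiniteType k ↥B := hess
  haveI : IsNoetherianRing ↥B := Algebra.EssFiniteType.isNoetherianRing k ↥B
  have hCψ : (algebraMap (Polynomial ↥B) ↥E).comp (C : ↥B →+* Polynomial ↥B) = ψ := by
    refine RingHom.ext fun b => ?_
    change Polynomial.eval₂RingHom ψ XE (C b) = ψ b
    rw [Polynomial.coe_eval₂RingHom, Polynomial.eval₂_C]
  rw [singIdeal_eq_vanishingIdeal, singIdeal_eq_vanishingIdeal,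
    vanishingIdeal_compl_regularLocus_of_isLocalization_polynomial k ↥B ↥E
      ((nonZeroDivisors (Polynomial k)).map (Polynomial.mapRingHom (algebraMap k ↥B))),
    Ideal.map_map, hCψ]

end Summit.ResolutionOfSingularities.ResolutionOfSingularities.Theorems.SyzygyFlattening

end
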